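import Mathlib
import HarnessLib

/-!
# The replica `t`-statistic at fixed `R`: an a.e.-continuous mapping theorem, the null diagonal of a product law, and `t(V_n) ⇒ t(Z)`, `Z ~ N(0, v)^{⊗R}`, for ANY replica vector `V_n ⇒ N(0, v)^{⊗R}` (`v ≠ 0`, `R ≥ 2`)

HONEST FRAMING: exact (Metropolis-corrected) sampling algorithms for lattice gauge theory;
figures of merit are autocorrelation/cost numbers at stated couplings and volumes; no
continuum-physics claim.

Venture `LatticeQCDFlow` (cell pub-lqcd), topic `Exactness`; FANOUT row 13 (`eng-snf`, GEN-23, replica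
pooling).  NEW WORK of the cell against Mathlib only (portmanteau `tendsto_of_forall_isOpen_le_liminf'`,
`ProbabilityMeasure.le_liminf_measure_open_of_tendsto`, `IsGδ.setOf_continuousAt`, `iIndepFun_pi`,
`measure_prod_null_of_ae_null`, `nullSingletonClass_gaussianReal`); not a published result; no
definition is introduced; nothing is cited as a fact (Student's `t_{R−1}` calibration of the
"many short chains" error bar is NAMED ONLY).

WHY (row 13).  `latflow-snf`'s `estimators.free_energy` reports a replica / block JACKKNIFE error bar,
i.e. the studentised statistic `t_n = (ȳ̄_n − πf) / √(Σ_r (ȳ_{r,n} − ȳ̄_n)² / (R(R−1)))` built from the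
SPREAD of `R` replica means.  GEN-23's replica-vector CLT gives `V_n = (√n (ȳ_{r,n} − πf))_r ⇒ Z ~
N(0, σ²_f)^{⊗R}`; since `t` is invariant under positive scaling, `t_n = t(V_n)`, and the limit law of
`t_n` is the pushforward of the product Gaussian under `t(z) = z̄ / √(Σ_r (z_r − z̄)²/(R(R−1)))` — provided
the continuous mapping theorem applies.  `t` is NOT continuous (it blows up on the diagonal
`{z | Σ_r (z_r − z̄)² = 0}`), so Mathlib's `TendstoInDistribution.continuous_comp` does not apply; what is
needed is the a.e.-version (continuity off a set the LIMIT law does not charge), typed here in general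
(§1), together with the fact that a product law with an atomless factor does not charge
`{z | z_r = z_s}` (`r ≠ s`, §2), whence the diagonal is null for `N(0, v)^{⊗R}`, `v ≠ 0`, `R ≥ 2`.

## Content (generic; the chain-replica instance only has to feed its vector CLT into §4)
* **`TendstoInDistribution.comp_of_ae_continuousAt`** (§1) — `X_n ⇒ Z`, `g` measurable and continuous at
  `Z(ω')` for a.e. `ω'` ⇒ `g(X_n) ⇒ g(Z)` (portmanteau through open sets: `g⁻¹ G ⊆ interior ∪ disc(g)`).
* **`pi_measure_setOf_eval_eq_eval`** (§2) — `(⊗_i μ_i){z | z_r = z_s} = 0` for `r ≠ s`, `μ_s` atomless;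
  `eval_eq_eval_of_sumSqDev_eq_zero`, **`ae_sumSqDev_ne_zero_pi_gaussianReal`**.
* `measurable_tStat`, **`continuousAt_tStat`** (§3) — `t` is Borel and continuous off the diagonal;
  `tStat_mul_left` — `t(c • a) = t(a)` for `c > 0`; `tStat_replicaMeans_eq` — `t` of
  `(ȳ_r − θ)_r` is the studentised pooled mean `(ȳ̄ − θ)/√(Σ_r (ȳ_r − ȳ̄)²/(R(R−1)))`.
* **`tendstoInDistribution_tStat_of_pi_gaussianReal`** (§4) — `V_n ⇒ N(0, v)^{⊗R}` in `EuclideanSpace ℝ ι`,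
  `v ≠ 0`, `R ≥ 2` ⇒ `t(V_n) ⇒ t(Z)`.

NOT CLAIMED: the identification of the limit law with Student's `t_{R−1}` (a computation on densities);
coverage statements `P(|t_n| ≤ q) → …` (they need, in addition, that the limit law does not charge
`{|t| = q}`); anything numerical.
-/

namespace Summit.Ventures.LatticeQCDFlow.Exactness.GeneralNCMC

open MeasureTheory ProbabilityTheory Set Filter Topology Finset WithLp
open scoped ENNReal NNReal Topology

/-! ## §1 The continuous mapping theorem for maps continuous a.e. under the limit law -/

section CMT

variable {Ω₀ : Type*} [MeasurableSpace Ω₀] {P : Measure Ω₀} [IsProbabilityMeasure P]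
  {Ω' : Type*} [MeasurableSpace Ω'] {P' : Measure Ω'} [IsProbabilityMeasure P']
  {E : Type*} [PseudoEMetricSpace E] [MeasurableSpace E] [BorelSpace E]
  {F : Type*} [PseudoEMetricSpace F] [MeasurableSpace F] [BorelSpace F]

/-- **The continuous mapping theorem for maps continuous almost everywhere under the limit law**:
if `X n ⇒ Z`, `g` is measurable and `g` is continuous at `Z ω'` for `P'`-a.e. `ω'`, then
`g (X n) ⇒ g Z`.  (Portmanteau, open sets: `g ⁻¹ G` differs from its interior only inside the
discontinuity set of `g`, which the law of `Z` does not charge.) -/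
theorem TendstoInDistribution.comp_of_ae_continuousAt {X : ℕ → Ω₀ → E} {Z : Ω' → E}
    (h : TendstoInDistribution X atTop Z (fun _ => P) P') {g : E → F} (hg : Measurable g)
    (hcont : ∀ᵐ ω' ∂P', ContinuousAt g (Z ω')) :
    TendstoInDistribution (fun n ω => g (X n ω)) atTop (fun ω' => g (Z ω')) (fun _ => P) P' := by
  have hXm : ∀ n, AEMeasurable (X n) P := h.forall_aemeasurable
  have hZm : AEMeasurable Z P' := h.aemeasurable_limit
  refine ⟨fun n => hg.comp_aemeasurable (hXm n), hg.comp_aemeasurable hZm, ?_⟩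
  apply tendsto_of_forall_isOpen_le_liminf'
  intro G hG
  simp only [ProbabilityMeasure.coe_mk]
  -- the interior `U` of `g ⁻¹ G` and the continuity set of `g`
  set U : Set E := interior (g ⁻¹' G) with hU
  have hUo : IsOpen U := isOpen_interior
  have hCm : MeasurableSet {x : E | ContinuousAt g x} := (IsGδ.setOf_continuousAt g).measurableSet
  -- `g ⁻¹ G ⊆ U ∪ {discontinuity points}`
  have hsub : g ⁻¹' G ⊆ U ∪ {x : E | ContinuousAt g x}ᶜ := by
    intro x hx
    by_cases hc : ContinuousAt g x
    · left
      exact mem_interior_iff_mem_nhds.2 (hc.preimage_mem_nhds (hG.mem_nhds hx))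
    · right; exact hc
  -- the discontinuity set is null for the law of `Z`
  have hDnull : (P'.map Z) {x : E | ContinuousAt g x}ᶜ = 0 := by
    rw [Measure.map_apply_of_aemeasurable hZm hCm.compl]
    exact ae_iff.1 hcont
  have hgZ : AEMeasurable (fun ω' => g (Z ω')) P' := hg.comp_aemeasurable hZm
  have hgX : ∀ n, AEMeasurable (fun ω => g (X n ω)) P := fun n => hg.comp_aemeasurable (hXm n)
  -- the limit side: `(P'.map (g ∘ Z)) G = (P'.map Z) (g ⁻¹ G) ≤ (P'.map Z) U`
  have hlimit : (P'.map fun ω' => g (Z ω')) G ≤ (P'.map Z) U := by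
    rw [Measure.map_apply_of_aemeasurable hgZ hG.measurableSet,
      show (fun ω' => g (Z ω')) ⁻¹' G = Z ⁻¹' (g ⁻¹' G) from rfl,
      ← Measure.map_apply_of_aemeasurable hZm (hg hG.measurableSet)]
    calc (P'.map Z) (g ⁻¹' G) ≤ (P'.map Z) (U ∪ {x : E | ContinuousAt g x}ᶜ) := measure_mono hsub
      _ ≤ (P'.map Z) U + (P'.map Z) {x : E | ContinuousAt g x}ᶜ := measure_union_le _ _
      _ = (P'.map Z) U := by rw [hDnull, add_zero]
  -- portmanteau on the open set `U` for `X n ⇒ Z`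
  have hport := ProbabilityMeasure.le_liminf_measure_open_of_tendsto h.tendsto hUo
  simp only [ProbabilityMeasure.coe_mk] at hport
  -- the sequence side: `(P.map (X n)) U ≤ (P.map (g ∘ X n)) G`
  have hseq : ∀ n, (P.map (X n)) U ≤ (P.map fun ω => g (X n ω)) G := by
    intro n
    rw [Measure.map_apply_of_aemeasurable (hXm n) hUo.measurableSet,
      Measure.map_apply_of_aemeasurable (hgX n) hG.measurableSet]
    exact measure_mono fun ω hω => show g (X n ω) ∈ G from interior_subset (s := g ⁻¹' G) hω
  calc (P'.map fun ω' => g (Z ω')) G ≤ (P'.map Z) U := hlimit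
    _ ≤ liminf (fun n => (P.map (X n)) U) atTop := hport
    _ ≤ liminf (fun n => (P.map fun ω => g (X n ω)) G) atTop :=
        liminf_le_liminf (Eventually.of_forall hseq)

end CMT

/-! ## §2 Distinct coordinates of a product law with an atomless factor coincide only on a null set -/

section Diagonal

variable {ι : Type*} [Fintype ι]

/-- **A product of probability laws does not charge `{z | z_r = z_s}`** (`r ≠ s`) as soon as the `s`-th
factor has no atoms: the pair `(z_r, z_s)` has the product law (independence of distinct coordinates,
`iIndepFun_pi`), and every section of the diagonal is a singleton. -/
theorem pi_measure_setOf_eval_eq_eval {μ : ι → Measure ℝ} [∀ i, IsProbabilityMeasure (μ i)]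
    {r s : ι} (hrs : r ≠ s) [NullSingletonClass (μ s)] :
    Measure.pi μ {z : ι → ℝ | z r = z s} = 0 := by
  have hind : iIndepFun (fun i (z : ι → ℝ) => z i) (Measure.pi μ) :=
    iIndepFun_pi (X := fun _ => id) fun _ => aemeasurable_id
  have h2 : IndepFun (fun z : ι → ℝ => z r) (fun z : ι → ℝ => z s) (Measure.pi μ) := hind.indepFun hrs
  have hr : (Measure.pi μ).map (fun z : ι → ℝ => z r) = μ r := (measurePreserving_eval μ r).map_eq
  have hs : (Measure.pi μ).map (fun z : ι → ℝ => z s) = μ s := (measurePreserving_eval μ s).map_eq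
  have hpair : (Measure.pi μ).map (fun z : ι → ℝ => (z r, z s)) = (μ r).prod (μ s) := by
    rw [(indepFun_iff_map_prod_eq_prod_map_map (measurable_pi_apply r).aemeasurable
      (measurable_pi_apply s).aemeasurable).1 h2, hr, hs]
  have hmeas : Measurable fun z : ι → ℝ => (z r, z s) :=
    (measurable_pi_apply r).prodMk (measurable_pi_apply s)
  have hset : {z : ι → ℝ | z r = z s} = (fun z : ι → ℝ => (z r, z s)) ⁻¹' diagonal ℝ := rfl
  rw [hset, ← Measure.map_apply hmeas measurableSet_diagonal, hpair]
  refine Measure.measure_prod_null_of_ae_null measurableSet_diagonal (Eventually.of_forall fun x => ?_)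
  have hx : Prod.mk x ⁻¹' diagonal ℝ = {x} := by
    ext y
    simp only [Set.mem_preimage, Set.mem_diagonal_iff, Set.mem_singleton_iff]
    exact eq_comm
  show μ s (Prod.mk x ⁻¹' diagonal ℝ) = 0
  rw [hx]
  exact measure_singleton x

/-- If the sum of squared deviations from the mean vanishes, all coordinates coincide. -/
theorem eval_eq_eval_of_sumSqDev_eq_zero (z : ι → ℝ)
    (h : ∑ r, (z r - (∑ r', z r') / Fintype.card ι) ^ 2 = 0) (r s : ι) : z r = z s := by
  have h0 : ∀ i ∈ Finset.univ, (z i - (∑ r', z r') / Fintype.card ι) ^ 2 = 0 :=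
    (sum_eq_zero_iff_of_nonneg fun i _ => sq_nonneg _).1 h
  have hr := h0 r (Finset.mem_univ r)
  have hs := h0 s (Finset.mem_univ s)
  rw [sq_eq_zero_iff, sub_eq_zero] at hr hs
  rw [hr, hs]

/-- **The product Gaussian `N(m, v)^{⊗R}` (`v ≠ 0`, `R ≥ 2`) a.s. has a non-zero sum of squared
deviations** — the replica `t`-statistic's denominator does not vanish under the limit law. -/
theorem ae_sumSqDev_ne_zero_pi_gaussianReal [Nontrivial ι] (m : ℝ) {v : ℝ≥0} (hv : v ≠ 0) :
    ∀ᵐ z ∂(Measure.pi fun _ : ι => gaussianReal m v),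
      (∑ r, (z r - (∑ r', z r') / (Fintype.card ι : ℝ)) ^ 2) ≠ 0 := by
  obtain ⟨r, s, hrs⟩ := exists_pair_ne ι
  have : NullSingletonClass (gaussianReal m v) := nullSingletonClass_gaussianReal hv
  rw [ae_iff]
  refine measure_mono_null (fun z hz => ?_)
    (pi_measure_setOf_eval_eq_eval (μ := fun _ : ι => gaussianReal m v) hrs)
  simp only [ne_eq, not_not, mem_setOf_eq] at hz
  exact eval_eq_eval_of_sumSqDev_eq_zero z hz r s

end Diagonal

/-! ## §3 The studentised mean `t(x) = x̄ / √(Σ_r (x_r − x̄)²/(R(R−1)))` on `EuclideanSpace ℝ ι` -/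

section TStat

variable {ι : Type*} [Fintype ι]

/-- `t` is Borel measurable on `EuclideanSpace ℝ ι`. -/
theorem measurable_tStat :
    Measurable fun x : PiLp 2 (fun _ : ι => ℝ) =>
      (∑ r, x r) / Fintype.card ι
        / Real.sqrt ((∑ r, (x r - (∑ r', x r') / Fintype.card ι) ^ 2)
            / ((Fintype.card ι : ℝ) * (Fintype.card ι - 1))) := by
  have hc : ∀ r : ι, Continuous fun x : PiLp 2 (fun _ : ι => ℝ) => x r := fun r =>
    PiLp.continuous_apply 2 _ r
  have hnum : Continuous fun x : PiLp 2 (fun _ : ι => ℝ) => (∑ r, x r) / Fintype.card ι := by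
    fun_prop
  have hden : Continuous fun x : PiLp 2 (fun _ : ι => ℝ) =>
      Real.sqrt ((∑ r, (x r - (∑ r', x r') / Fintype.card ι) ^ 2)
        / ((Fintype.card ι : ℝ) * (Fintype.card ι - 1))) := by
    fun_prop
  exact hnum.measurable.div hden.measurable

/-- **`t` is continuous off the diagonal** `{Σ_r (x_r − x̄)² = 0}` (there the denominator is the
square root of a positive number when `R ≥ 2`). -/
theorem continuousAt_tStat [Nontrivial ι] {x : PiLp 2 (fun _ : ι => ℝ)}
    (hx : (∑ r, (x r - (∑ r', x r') / Fintype.card ι) ^ 2) ≠ 0) :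
    ContinuousAt (fun x : PiLp 2 (fun _ : ι => ℝ) =>
      (∑ r, x r) / Fintype.card ι
        / Real.sqrt ((∑ r, (x r - (∑ r', x r') / Fintype.card ι) ^ 2)
            / ((Fintype.card ι : ℝ) * (Fintype.card ι - 1)))) x := by
  have hc : ∀ r : ι, Continuous fun x : PiLp 2 (fun _ : ι => ℝ) => x r := fun r =>
    PiLp.continuous_apply 2 _ r
  have hnum : Continuous fun x : PiLp 2 (fun _ : ι => ℝ) => (∑ r, x r) / Fintype.card ι := by
    fun_prop
  have hden : Continuous fun x : PiLp 2 (fun _ : ι => ℝ) =>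
      Real.sqrt ((∑ r, (x r - (∑ r', x r') / Fintype.card ι) ^ 2)
        / ((Fintype.card ι : ℝ) * (Fintype.card ι - 1))) := by
    fun_prop
  refine hnum.continuousAt.div hden.continuousAt ?_
  have hR : (1 : ℝ) < Fintype.card ι := by exact_mod_cast Fintype.one_lt_card
  have hpos : 0 < (∑ r, (x r - (∑ r', x r') / Fintype.card ι) ^ 2)
      / ((Fintype.card ι : ℝ) * (Fintype.card ι - 1)) :=
    div_pos (lt_of_le_of_ne (sum_nonneg fun r _ => sq_nonneg _) (Ne.symm hx))
      (mul_pos (by linarith) (by linarith))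
  exact (Real.sqrt_pos.2 hpos).ne'

/-- **`t` is invariant under positive scaling**: `t(c • a) = t(a)` for `0 < c`. -/
theorem tStat_mul_left (a : ι → ℝ) {c : ℝ} (hc : 0 < c) :
    (∑ r, c * a r) / Fintype.card ι
        / Real.sqrt ((∑ r, (c * a r - (∑ r', c * a r') / Fintype.card ι) ^ 2)
            / ((Fintype.card ι : ℝ) * (Fintype.card ι - 1)))
      = (∑ r, a r) / Fintype.card ι
        / Real.sqrt ((∑ r, (a r - (∑ r', a r') / Fintype.card ι) ^ 2)
            / ((Fintype.card ι : ℝ) * (Fintype.card ι - 1))) := by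
  have h1 : ∑ r, c * a r = c * ∑ r, a r := (mul_sum _ _ _).symm
  have h2 : ∑ r, (c * a r - (∑ r', c * a r') / (Fintype.card ι : ℝ)) ^ 2
      = c ^ 2 * ∑ r, (a r - (∑ r', a r') / (Fintype.card ι : ℝ)) ^ 2 :=
    calc ∑ r, (c * a r - (∑ r', c * a r') / (Fintype.card ι : ℝ)) ^ 2
        = ∑ r, c ^ 2 * (a r - (∑ r', a r') / (Fintype.card ι : ℝ)) ^ 2 := by
          rw [h1]
          exact sum_congr rfl fun r _ => by ring
      _ = c ^ 2 * ∑ r, (a r - (∑ r', a r') / (Fintype.card ι : ℝ)) ^ 2 := (mul_sum _ _ _).symm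
  rw [h2, h1]
  set A := ∑ r, a r
  set B := ∑ r, (a r - A / (Fintype.card ι : ℝ)) ^ 2
  set R := (Fintype.card ι : ℝ) with hR
  rw [mul_div_assoc c A R, mul_div_assoc (c ^ 2) B (R * (R - 1)), Real.sqrt_mul (sq_nonneg c),
    Real.sqrt_sq hc.le, mul_div_mul_left _ _ hc.ne']

/-- **`t` of the centred replica means is the studentised pooled mean**:
`t((ȳ_r − θ)_r) = (ȳ̄ − θ) / √(Σ_r (ȳ_r − ȳ̄)² / (R(R−1)))`. -/
theorem tStat_sub_const [Nonempty ι] (y : ι → ℝ) (θ : ℝ) :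
    (∑ r, (y r - θ)) / Fintype.card ι
        / Real.sqrt ((∑ r, ((y r - θ) - (∑ r', (y r' - θ)) / Fintype.card ι) ^ 2)
            / ((Fintype.card ι : ℝ) * (Fintype.card ι - 1)))
      = ((∑ r, y r) / Fintype.card ι - θ)
        / Real.sqrt ((∑ r, (y r - (∑ r', y r') / Fintype.card ι) ^ 2)
            / ((Fintype.card ι : ℝ) * (Fintype.card ι - 1))) := by
  have hR : (Fintype.card ι : ℝ) ≠ 0 := Nat.cast_ne_zero.2 Fintype.card_ne_zero
  have h1 : (∑ r, (y r - θ)) / Fintype.card ι = (∑ r, y r) / Fintype.card ι - θ := by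
    rw [sum_sub_distrib, sum_const, card_univ, nsmul_eq_mul, sub_div, mul_div_cancel_left₀ θ hR]
  have h2 : ∀ r, (y r - θ) - (∑ r', (y r' - θ)) / Fintype.card ι
      = y r - (∑ r', y r') / Fintype.card ι := by
    intro r
    rw [h1]
    ring
  simp_rw [h2, h1]

end TStat

/-! ## §4 `t(V_n) ⇒ t(Z)` for any replica vector converging to a non-degenerate product Gaussian -/

section Limit

variable {ι : Type*} [Fintype ι] [Nontrivial ι]
  {Ω₀ : Type*} [MeasurableSpace Ω₀] {P : Measure Ω₀} [IsProbabilityMeasure P]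

/-- **THE REPLICA `t`-STATISTIC HAS THE LIMIT LAW `t(Z)`, `Z ~ N(0, v)^{⊗R}`** (`v ≠ 0`, `R ≥ 2`):
if the replica vector `V_n` (valued in `EuclideanSpace ℝ ι`) converges in distribution to the product
Gaussian, then `t(V_n) = V̄_n / √(Σ_r (V_{n,r} − V̄_n)²/(R(R−1))) ⇒ Z̄ / √(Σ_r (Z_r − Z̄)²/(R(R−1)))`
— the a.e.-continuous mapping theorem (§1), `t` being continuous off the diagonal (§3), which the
product Gaussian does not charge (§2).  With `V_n = (√n (ȳ_{r,n} − πf))_r` (GEN-23's replica-vector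
CLT) and `tStat_mul_left`/`tStat_sub_const`, `t(V_n)` IS the studentised pooled mean
`(ȳ̄_n − πf)/√(Σ_r (ȳ_{r,n} − ȳ̄_n)²/(R(R−1)))` for `n ≥ 1`. -/
theorem tendstoInDistribution_tStat_of_pi_gaussianReal {V : ℕ → Ω₀ → PiLp 2 (fun _ : ι => ℝ)}
    {v : ℝ≥0} (hv : v ≠ 0)
    (h : TendstoInDistribution V atTop (toLp 2) (fun _ => P)
      (Measure.pi fun _ : ι => gaussianReal 0 v)) :
    TendstoInDistribution
      (fun n ω => (∑ r, V n ω r) / Fintype.card ι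
        / Real.sqrt ((∑ r, (V n ω r - (∑ r', V n ω r') / Fintype.card ι) ^ 2)
            / ((Fintype.card ι : ℝ) * (Fintype.card ι - 1))))
      atTop
      (fun z : ι → ℝ => (∑ r, z r) / Fintype.card ι
        / Real.sqrt ((∑ r, (z r - (∑ r', z r') / Fintype.card ι) ^ 2)
            / ((Fintype.card ι : ℝ) * (Fintype.card ι - 1))))
      (fun _ => P) (Measure.pi fun _ : ι => gaussianReal 0 v) := by
  refine TendstoInDistribution.comp_of_ae_continuousAt h measurable_tStat ?_
  filter_upwards [ae_sumSqDev_ne_zero_pi_gaussianReal (ι := ι) 0 hv] with z hz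
  exact continuousAt_tStat hz

/-- The same with the replica vector given coordinatewise (`V_n = toLp 2 (W_n)`, `W_n : Ω → ι → ℝ`). -/
theorem tendstoInDistribution_tStat_of_pi_gaussianReal' {W : ℕ → Ω₀ → ι → ℝ}
    {v : ℝ≥0} (hv : v ≠ 0)
    (h : TendstoInDistribution (fun n ω => toLp 2 (W n ω)) atTop (toLp 2) (fun _ => P)
      (Measure.pi fun _ : ι => gaussianReal 0 v)) :
    TendstoInDistribution
      (fun n ω => (∑ r, W n ω r) / Fintype.card ι
        / Real.sqrt ((∑ r, (W n ω r - (∑ r', W n ω r') / Fintype.card ι) ^ 2)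
            / ((Fintype.card ι : ℝ) * (Fintype.card ι - 1))))
      atTop
      (fun z : ι → ℝ => (∑ r, z r) / Fintype.card ι
        / Real.sqrt ((∑ r, (z r - (∑ r', z r') / Fintype.card ι) ^ 2)
            / ((Fintype.card ι : ℝ) * (Fintype.card ι - 1))))
      (fun _ => P) (Measure.pi fun _ : ι => gaussianReal 0 v) :=
  tendstoInDistribution_tStat_of_pi_gaussianReal hv h

end Limit

end Summit.Ventures.LatticeQCDFlow.Exactness.GeneralNCMC
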